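import Literature.Geometry.Riemannian.SphericalZonalGaussianBounds
import Literature.Analysis.SpecialFunctions.GegenbauerSupBound
import Mathlib.Analysis.SpecificLimits.Basic
import HarnessLib

/-!
# Sharp term bounds and a sharp geometric tail for the zonal heat series of `S⁴`

Seventh file on the typed zonal heat series
`zonal τ s = ∑_k e^{-k(k+3)τ} (2k+3)/3 · C_k^{(3/2)}(s)` of `SphericalCylinderEntropy.lean`
(`vol(S⁴)` times the heat kernel of the round `S⁴`).  `SphericalZonalGaussianBounds.lean` bounds
the tail of the rational-weight partial sums at `τ = -(log q)/2` through the crude term bound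
`|wt k τ C_k(s)| ≤ e^{-k(k+3)τ} 32^k`; here we replace `32^k` by the SHARP value
`|C_k^{(3/2)}(s)| ≤ C_k^{(3/2)}(1) = (k+1)(k+2)/2` (Andrews–Askey–Roy (6.4.11), the tree's
`abs_gegenbauerSum_le_gegenbauerSum_one`), which makes the tail after `K` terms comparable to the
first omitted term already for moderate `q`:

* `abs_gegen_le_gegen_one` — **`|C_k^{(3/2)}(s)| ≤ (k+1)(k+2)/2`** on `[-1, 1]`;
* `abs_term_neg_log_div_two_le` — `|wt k τ C_k(s)| ≤ t_k := q^{k(k+3)/2} (2k+3)(k+1)(k+2)/6` at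
  `τ = -(log q)/2`;
* `sharpMajorant_succ_le`, `sharpMajorant_le_mul_pow` — the ratio bound
  `t_{m+1} ≤ r t_m` for `m ≥ K + 1`, `r := q^{K+3} (2K+7)(K+3)(K+4) / ((2K+5)(K+2)(K+3))`
  (`t_{m+1}/t_m = q^{m+2} p(m+1)/p(m)`, `p(m) = (2m+3)(m+1)(m+2)`, and `p(m+1)/p(m)` decreases),
  hence `t_{K+1+i} ≤ t_{K+1} r^i`;
* `abs_zonal_sub_partialSum_le_sharp` — **the sharp geometric tail**
  `|zonal (-(log q)/2) s - Σ_{k ≤ K} q^{k(k+3)/2} (2k+3)/3 · C_k(s)| ≤ t_{K+1} / (1 - r)` for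
  `|s| ≤ 1` and `r < 1`, with the two one-sided forms `partialSum_sub_sharp_le_zonal`,
  `zonal_le_partialSum_add_sharp` and the pole form `abs_zonal_one_sub_partialSum_le_sharp`.
An `example` at the end shows the `norm_num` recipe (`q = 1/4`, `K = 4`: tail `< 10⁻¹⁰`).

Everything is proved; no definitions, no named facts.

## References
* G. E. Andrews, R. Askey, R. Roy, *Special Functions*, CUP 1999, §6.4, (6.4.11).
  [AndrewsAskeyRoy1999]
* NIST DLMF 18.14.4.
-/

noncomputable section

open scoped BigOperators
open Literature.Geometry.Riemannian.SphericalCylinderEntropy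
open Literature.Analysis.SpecialFunctions

namespace Literature.Geometry.Riemannian.SphericalZonalKernelSeries

/-! ### The sharp bound for the typed Gegenbauer polynomials -/

/-- **`|C_k^{(3/2)}(s)| ≤ C_k^{(3/2)}(1) = (k+1)(k+2)/2`** for `|s| ≤ 1` (the classical sharp sup
bound of the ultraspherical polynomials, AAR (6.4.11) / DLMF 18.14.4, through
`abs_gegenbauerSum_le_gegenbauerSum_one` and `gegen_one`). [cite: AndrewsAskeyRoy1999, (6.4.11)] -/
theorem abs_gegen_le_gegen_one (k : ℕ) {s : ℝ} (hs : |s| ≤ 1) :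
    |gegen k s| ≤ ((k : ℝ) + 1) * ((k : ℝ) + 2) / 2 := by
  rw [← gegen_one k, gegen_eq_gegenbauerSum, gegen_eq_gegenbauerSum]
  exact abs_gegenbauerSum_le_gegenbauerSum_one (by positivity) k hs

/-- **Sharp term bound at `τ = -(log q)/2`**: for `q > 0` and `|s| ≤ 1`,
`|wt k τ · C_k(s)| ≤ q^{k(k+3)/2} (2k+3)(k+1)(k+2)/6`. [folklore] -/
theorem abs_term_neg_log_div_two_le {q : ℝ} (hq0 : 0 < q) (k : ℕ) {s : ℝ} (hs : |s| ≤ 1) :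
    |wt k (-(Real.log q) / 2) * gegen k s| ≤
      q ^ (k * (k + 3) / 2) * ((2 * (k : ℝ) + 3) * ((k : ℝ) + 1) * ((k : ℝ) + 2) / 6) := by
  rw [abs_mul, wt_neg_log_div_two hq0,
    abs_of_nonneg (by positivity : (0 : ℝ) ≤ q ^ (k * (k + 3) / 2) * ((2 * (k : ℝ) + 3) / 3))]
  calc q ^ (k * (k + 3) / 2) * ((2 * (k : ℝ) + 3) / 3) * |gegen k s|
      ≤ q ^ (k * (k + 3) / 2) * ((2 * (k : ℝ) + 3) / 3) * (((k : ℝ) + 1) * ((k : ℝ) + 2) / 2) :=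
        mul_le_mul_of_nonneg_left (abs_gegen_le_gegen_one k hs) (by positivity)
    _ = q ^ (k * (k + 3) / 2) * ((2 * (k : ℝ) + 3) * ((k : ℝ) + 1) * ((k : ℝ) + 2) / 6) := by
        ring

/-! ### The ratio bound for the sharp majorant `t_m = q^{m(m+3)/2} (2m+3)(m+1)(m+2)/6` -/

/-- **Ratio step**: for `0 ≤ q ≤ 1` and `m ≥ K + 1`,
`t_{m+1} ≤ r · t_m` with `r = q^{K+3} (2K+7)(K+3)(K+4) / ((2K+5)(K+2)(K+3))`
(`t_{m+1}/t_m = q^{m+2} · p(m+1)/p(m)`, `p(m) = (2m+3)(m+1)(m+2)`, `q^{m+2} ≤ q^{K+3}` and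
`p(m+1)/p(m) ≤ p(K+2)/p(K+1)` as `p(m+1)/p(m)` is decreasing in `m`). [folklore] -/
theorem sharpMajorant_succ_le {q : ℝ} (hq0 : 0 ≤ q) (hq1 : q ≤ 1) {K m : ℕ} (hm : K + 1 ≤ m) :
    q ^ ((m + 1) * (m + 1 + 3) / 2) *
        ((2 * ((m + 1 : ℕ) : ℝ) + 3) * (((m + 1 : ℕ) : ℝ) + 1) * (((m + 1 : ℕ) : ℝ) + 2) / 6) ≤
      q ^ (K + 3) * ((2 * (K : ℝ) + 7) * ((K : ℝ) + 3) * ((K : ℝ) + 4)) /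
          ((2 * (K : ℝ) + 5) * ((K : ℝ) + 2) * ((K : ℝ) + 3)) *
        (q ^ (m * (m + 3) / 2) * ((2 * (m : ℝ) + 3) * ((m : ℝ) + 1) * ((m : ℝ) + 2) / 6)) := by
  have hexp : (m + 1) * (m + 1 + 3) / 2 = m * (m + 3) / 2 + (m + 2) := by
    have h1 : (m + 1) * (m + 1 + 3) = m * (m + 3) + 2 * (m + 2) := by ring
    have h2 := two_mul_half_mul_add_three m
    omega
  have hqpow : q ^ (m + 2) ≤ q ^ (K + 3) := pow_le_pow_of_le_one hq0 hq1 (by omega)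
  have hB : 0 < (2 * (K : ℝ) + 5) * ((K : ℝ) + 2) * ((K : ℝ) + 3) := by positivity
  -- `p(m+1) p(K+1) ≤ p(K+2) p(m)` for `m = K + 1 + j`: the difference is a polynomial in `K, j`
  -- with nonnegative coefficients.
  have hpoly : (2 * ((m : ℝ) + 1) + 3) * ((m : ℝ) + 1 + 1) * ((m : ℝ) + 1 + 2) *
        ((2 * (K : ℝ) + 5) * ((K : ℝ) + 2) * ((K : ℝ) + 3)) ≤
      (2 * (K : ℝ) + 7) * ((K : ℝ) + 3) * ((K : ℝ) + 4) *
        ((2 * (m : ℝ) + 3) * ((m : ℝ) + 1) * ((m : ℝ) + 2)) := by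
    obtain ⟨j, rfl⟩ := Nat.exists_eq_add_of_le hm
    push_cast
    have key : (2 * (K : ℝ) + 7) * ((K : ℝ) + 3) * ((K : ℝ) + 4) *
          ((2 * ((K : ℝ) + 1 + j) + 3) * ((K : ℝ) + 1 + j + 1) * ((K : ℝ) + 1 + j + 2)) -
        (2 * ((K : ℝ) + 1 + j + 1) + 3) * ((K : ℝ) + 1 + j + 1 + 1) * ((K : ℝ) + 1 + j + 1 + 2) *
          ((2 * (K : ℝ) + 5) * ((K : ℝ) + 2) * ((K : ℝ) + 3)) =
        (j : ℝ) * (918 + 630 * j + 108 * (j : ℝ) ^ 2 + 1260 * K + 642 * K * j +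
          72 * K * (j : ℝ) ^ 2 + 642 * (K : ℝ) ^ 2 + 216 * (K : ℝ) ^ 2 * j +
          12 * (K : ℝ) ^ 2 * (j : ℝ) ^ 2 + 144 * (K : ℝ) ^ 3 + 24 * (K : ℝ) ^ 3 * j +
          12 * (K : ℝ) ^ 4) := by
      ring
    have hnn : 0 ≤ (j : ℝ) * (918 + 630 * j + 108 * (j : ℝ) ^ 2 + 1260 * K + 642 * K * j +
          72 * K * (j : ℝ) ^ 2 + 642 * (K : ℝ) ^ 2 + 216 * (K : ℝ) ^ 2 * j +
          12 * (K : ℝ) ^ 2 * (j : ℝ) ^ 2 + 144 * (K : ℝ) ^ 3 + 24 * (K : ℝ) ^ 3 * j +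
          12 * (K : ℝ) ^ 4) := by
      positivity
    linarith
  rw [hexp, pow_add, div_mul_eq_mul_div, le_div_iff₀ hB]
  push_cast
  have hqe : 0 ≤ q ^ (m * (m + 3) / 2) := pow_nonneg hq0 _
  have hqK : 0 ≤ q ^ (K + 3) := pow_nonneg hq0 _
  have hmain := mul_le_mul_of_nonneg_left (mul_le_mul hqpow hpoly (by positivity) hqK) hqe
  calc _ = q ^ (m * (m + 3) / 2) * (q ^ (m + 2) *
        ((2 * ((m : ℝ) + 1) + 3) * ((m : ℝ) + 1 + 1) * ((m : ℝ) + 1 + 2) *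
          ((2 * (K : ℝ) + 5) * ((K : ℝ) + 2) * ((K : ℝ) + 3)))) / 6 := by
        ring
    _ ≤ q ^ (m * (m + 3) / 2) * (q ^ (K + 3) *
        ((2 * (K : ℝ) + 7) * ((K : ℝ) + 3) * ((K : ℝ) + 4) *
          ((2 * (m : ℝ) + 3) * ((m : ℝ) + 1) * ((m : ℝ) + 2)))) / 6 :=
        div_le_div_of_nonneg_right hmain (by norm_num)
    _ = _ := by ring

/-- **Geometric domination of the sharp majorant**: for `0 ≤ q ≤ 1` and all `i`,
`t_{K+1+i} ≤ t_{K+1} · r^i` with `t`, `r` as in `sharpMajorant_succ_le` (induction on `i`).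
[folklore] -/
theorem sharpMajorant_le_mul_pow {q : ℝ} (hq0 : 0 ≤ q) (hq1 : q ≤ 1) (K i : ℕ) :
    q ^ ((i + (K + 1)) * (i + (K + 1) + 3) / 2) *
        ((2 * ((i + (K + 1) : ℕ) : ℝ) + 3) * (((i + (K + 1) : ℕ) : ℝ) + 1) *
          (((i + (K + 1) : ℕ) : ℝ) + 2) / 6) ≤
      q ^ ((K + 1) * (K + 4) / 2) * ((2 * (K : ℝ) + 5) * ((K : ℝ) + 2) * ((K : ℝ) + 3) / 6) *
        (q ^ (K + 3) * ((2 * (K : ℝ) + 7) * ((K : ℝ) + 3) * ((K : ℝ) + 4)) /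
          ((2 * (K : ℝ) + 5) * ((K : ℝ) + 2) * ((K : ℝ) + 3))) ^ i := by
  induction i with
  | zero =>
    have e1 : 0 + (K + 1) = K + 1 := Nat.zero_add _
    have e2 : K + 1 + 3 = K + 4 := rfl
    rw [e1, e2, pow_zero, mul_one]
    push_cast
    apply le_of_eq
    ring
  | succ i ih =>
    have e : i + 1 + (K + 1) = i + (K + 1) + 1 := by omega
    rw [e]
    refine (sharpMajorant_succ_le hq0 hq1 (K := K) (m := i + (K + 1)) (by omega)).trans ?_
    have hr0 : 0 ≤ q ^ (K + 3) * ((2 * (K : ℝ) + 7) * ((K : ℝ) + 3) * ((K : ℝ) + 4)) /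
        ((2 * (K : ℝ) + 5) * ((K : ℝ) + 2) * ((K : ℝ) + 3)) := by positivity
    calc _ ≤ q ^ (K + 3) * ((2 * (K : ℝ) + 7) * ((K : ℝ) + 3) * ((K : ℝ) + 4)) /
          ((2 * (K : ℝ) + 5) * ((K : ℝ) + 2) * ((K : ℝ) + 3)) *
        (q ^ ((K + 1) * (K + 4) / 2) * ((2 * (K : ℝ) + 5) * ((K : ℝ) + 2) * ((K : ℝ) + 3) / 6) *
          (q ^ (K + 3) * ((2 * (K : ℝ) + 7) * ((K : ℝ) + 3) * ((K : ℝ) + 4)) /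
            ((2 * (K : ℝ) + 5) * ((K : ℝ) + 2) * ((K : ℝ) + 3))) ^ i) :=
          mul_le_mul_of_nonneg_left ih hr0
      _ = _ := by rw [pow_succ]; ring

/-! ### The sharp geometric tail -/

/-- **Partial sums with the sharp geometric tail**: for `0 < q < 1`, `|s| ≤ 1`, `K : ℕ`, put
`t_{K+1} := q^{(K+1)(K+4)/2} (2K+5)(K+2)(K+3)/6` (the sharp bound for the first omitted term) and
`r := q^{K+3} (2K+7)(K+3)(K+4) / ((2K+5)(K+2)(K+3))` (a bound for all later term ratios); if
`r < 1` then
`|zonal (-(log q)/2) s - Σ_{k ≤ K} q^{k(k+3)/2} (2k+3)/3 · C_k^{(3/2)}(s)| ≤ t_{K+1} / (1 - r)`.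
[folklore] -/
theorem abs_zonal_sub_partialSum_le_sharp {q : ℝ} (hq0 : 0 < q) (hq1 : q < 1) (K : ℕ) {s : ℝ}
    (hs : |s| ≤ 1)
    (hr : q ^ (K + 3) * ((2 * (K : ℝ) + 7) * ((K : ℝ) + 3) * ((K : ℝ) + 4)) <
      (2 * (K : ℝ) + 5) * ((K : ℝ) + 2) * ((K : ℝ) + 3)) :
    |zonal (-(Real.log q) / 2) s -
        ∑ k ∈ Finset.range (K + 1), q ^ (k * (k + 3) / 2) * ((2 * (k : ℝ) + 3) / 3) * gegen k s|
      ≤ q ^ ((K + 1) * (K + 4) / 2) * ((2 * (K : ℝ) + 5) * ((K : ℝ) + 2) * ((K : ℝ) + 3) / 6) /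
          (1 - q ^ (K + 3) * ((2 * (K : ℝ) + 7) * ((K : ℝ) + 3) * ((K : ℝ) + 4)) /
            ((2 * (K : ℝ) + 5) * ((K : ℝ) + 2) * ((K : ℝ) + 3))) := by
  have hτ := neg_log_div_two_pos hq0 hq1
  have hsum := summable_term_of_pos hτ hs
  have hsplit := hsum.sum_add_tsum_nat_add (K + 1)
  have heq : zonal (-(Real.log q) / 2) s -
      ∑ k ∈ Finset.range (K + 1), q ^ (k * (k + 3) / 2) * ((2 * (k : ℝ) + 3) / 3) * gegen k s =
      ∑' i : ℕ, wt (i + (K + 1)) (-(Real.log q) / 2) * gegen (i + (K + 1)) s := by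
    have hS : ∑ k ∈ Finset.range (K + 1), q ^ (k * (k + 3) / 2) * ((2 * (k : ℝ) + 3) / 3) *
        gegen k s = ∑ k ∈ Finset.range (K + 1), wt k (-(Real.log q) / 2) * gegen k s :=
      Finset.sum_congr rfl fun k _ => by rw [wt_neg_log_div_two hq0]
    rw [hS, zonal, ← hsplit, add_sub_cancel_left]
  rw [heq]
  have hB : 0 < (2 * (K : ℝ) + 5) * ((K : ℝ) + 2) * ((K : ℝ) + 3) := by positivity
  have hr0 : 0 ≤ q ^ (K + 3) * ((2 * (K : ℝ) + 7) * ((K : ℝ) + 3) * ((K : ℝ) + 4)) /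
      ((2 * (K : ℝ) + 5) * ((K : ℝ) + 2) * ((K : ℝ) + 3)) := by positivity
  have hr1 : q ^ (K + 3) * ((2 * (K : ℝ) + 7) * ((K : ℝ) + 3) * ((K : ℝ) + 4)) /
      ((2 * (K : ℝ) + 5) * ((K : ℝ) + 2) * ((K : ℝ) + 3)) < 1 := (div_lt_one hB).2 hr
  have htail := tsum_of_norm_bounded
    (f := fun i : ℕ => wt (i + (K + 1)) (-(Real.log q) / 2) * gegen (i + (K + 1)) s)
    ((hasSum_geometric_of_lt_one hr0 hr1).mul_left
      (q ^ ((K + 1) * (K + 4) / 2) * ((2 * (K : ℝ) + 5) * ((K : ℝ) + 2) * ((K : ℝ) + 3) / 6)))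
    fun i => by
    rw [Real.norm_eq_abs]
    exact (abs_term_neg_log_div_two_le hq0 _ hs).trans (sharpMajorant_le_mul_pow hq0.le hq1.le K i)
  rw [Real.norm_eq_abs, ← div_eq_mul_inv] at htail
  exact htail

/-- Lower form: `Σ_{k ≤ K} q^{k(k+3)/2} (2k+3)/3 · C_k(s) - t_{K+1}/(1-r) ≤ zonal (-(log q)/2) s`.
[folklore] -/
theorem partialSum_sub_sharp_le_zonal {q : ℝ} (hq0 : 0 < q) (hq1 : q < 1) (K : ℕ) {s : ℝ}
    (hs : |s| ≤ 1)
    (hr : q ^ (K + 3) * ((2 * (K : ℝ) + 7) * ((K : ℝ) + 3) * ((K : ℝ) + 4)) <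
      (2 * (K : ℝ) + 5) * ((K : ℝ) + 2) * ((K : ℝ) + 3)) :
    ∑ k ∈ Finset.range (K + 1), q ^ (k * (k + 3) / 2) * ((2 * (k : ℝ) + 3) / 3) * gegen k s -
        q ^ ((K + 1) * (K + 4) / 2) * ((2 * (K : ℝ) + 5) * ((K : ℝ) + 2) * ((K : ℝ) + 3) / 6) /
          (1 - q ^ (K + 3) * ((2 * (K : ℝ) + 7) * ((K : ℝ) + 3) * ((K : ℝ) + 4)) /
            ((2 * (K : ℝ) + 5) * ((K : ℝ) + 2) * ((K : ℝ) + 3))) ≤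
      zonal (-(Real.log q) / 2) s := by
  have h := abs_le.1 (abs_zonal_sub_partialSum_le_sharp hq0 hq1 K hs hr)
  linarith [h.1]

/-- Upper form: `zonal (-(log q)/2) s ≤ Σ_{k ≤ K} q^{k(k+3)/2} (2k+3)/3 · C_k(s) + t_{K+1}/(1-r)`.
[folklore] -/
theorem zonal_le_partialSum_add_sharp {q : ℝ} (hq0 : 0 < q) (hq1 : q < 1) (K : ℕ) {s : ℝ}
    (hs : |s| ≤ 1)
    (hr : q ^ (K + 3) * ((2 * (K : ℝ) + 7) * ((K : ℝ) + 3) * ((K : ℝ) + 4)) <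
      (2 * (K : ℝ) + 5) * ((K : ℝ) + 2) * ((K : ℝ) + 3)) :
    zonal (-(Real.log q) / 2) s ≤
      ∑ k ∈ Finset.range (K + 1), q ^ (k * (k + 3) / 2) * ((2 * (k : ℝ) + 3) / 3) * gegen k s +
        q ^ ((K + 1) * (K + 4) / 2) * ((2 * (K : ℝ) + 5) * ((K : ℝ) + 2) * ((K : ℝ) + 3) / 6) /
          (1 - q ^ (K + 3) * ((2 * (K : ℝ) + 7) * ((K : ℝ) + 3) * ((K : ℝ) + 4)) /
            ((2 * (K : ℝ) + 5) * ((K : ℝ) + 2) * ((K : ℝ) + 3))) := by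
  have h := abs_le.1 (abs_zonal_sub_partialSum_le_sharp hq0 hq1 K hs hr)
  linarith [h.2]

/-- The sharp partial-sum bound at the pole `s = 1` (`C_k(1) = (k+1)(k+2)/2`):
`|zonal (-(log q)/2) 1 - Σ_{k ≤ K} q^{k(k+3)/2} (2k+3)/3 · (k+1)(k+2)/2| ≤ t_{K+1}/(1-r)`. [folklore] -/
theorem abs_zonal_one_sub_partialSum_le_sharp {q : ℝ} (hq0 : 0 < q) (hq1 : q < 1) (K : ℕ)
    (hr : q ^ (K + 3) * ((2 * (K : ℝ) + 7) * ((K : ℝ) + 3) * ((K : ℝ) + 4)) <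
      (2 * (K : ℝ) + 5) * ((K : ℝ) + 2) * ((K : ℝ) + 3)) :
    |zonal (-(Real.log q) / 2) 1 -
        ∑ k ∈ Finset.range (K + 1), q ^ (k * (k + 3) / 2) * ((2 * (k : ℝ) + 3) / 3) *
          (((k : ℝ) + 1) * ((k : ℝ) + 2) / 2)|
      ≤ q ^ ((K + 1) * (K + 4) / 2) * ((2 * (K : ℝ) + 5) * ((K : ℝ) + 2) * ((K : ℝ) + 3) / 6) /
          (1 - q ^ (K + 3) * ((2 * (K : ℝ) + 7) * ((K : ℝ) + 3) * ((K : ℝ) + 4)) /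
            ((2 * (K : ℝ) + 5) * ((K : ℝ) + 2) * ((K : ℝ) + 3))) := by
  have h := abs_zonal_sub_partialSum_le_sharp hq0 hq1 K (s := 1) (by norm_num) hr
  simpa only [gegen_one] using h

/-! ### Usage (how a certificate cell evaluates the sharp bounds with `norm_num`) -/

/-- `1.32628 ≤ zonal ((log 4)/2) 1 ≤ 1.32629` from five rational terms (`q = 1/4`, `K = 4`;
the sharp tail is `< 10⁻¹⁰`, against `≈ 3.5 · 10⁻⁵` for the `32^k` tail of
`abs_zonal_sub_partialSum_le_geometric`). [folklore] -/
example : (132628 / 100000 : ℝ) ≤ zonal (-(Real.log (1 / 4)) / 2) 1 ∧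
    zonal (-(Real.log (1 / 4)) / 2) 1 ≤ 132629 / 100000 := by
  have h1 := partialSum_sub_sharp_le_zonal (q := 1 / 4) (by norm_num) (by norm_num) 4 (s := 1)
    (by norm_num) (by norm_num)
  have h2 := zonal_le_partialSum_add_sharp (q := 1 / 4) (by norm_num) (by norm_num) 4 (s := 1)
    (by norm_num) (by norm_num)
  simp only [Finset.sum_range_succ, Finset.sum_range_zero, gegen_one] at h1 h2
  norm_num at h1 h2
  exact ⟨by linarith, by linarith⟩

end Literature.Geometry.Riemannian.SphericalZonalKernelSeries

end
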